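import Mathlib.NumberTheory.LSeries.DirichletContinuation
import Mathlib.NumberTheory.DirichletCharacter.Basic
import Mathlib.NumberTheory.MulChar.Basic
import Mathlib.NumberTheory.Harmonic.ZetaAsymp
import Mathlib.Analysis.SpecialFunctions.Pow.Real
import Mathlib.Analysis.SpecialFunctions.Log.Basic
import Mathlib.Analysis.SpecialFunctions.Sqrt
import HarnessLib

/-!
# Exceptional primes are sparse in the presence of a Siegel zero
# (Tao–Teräväinen 2022, Proposition 3.5 and Corollary 3.6 (first bound)), general conductor

Topic `Literature/NumberTheory/LFunctions`, sub-namespace `SiegelZero` (as the sibling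
`ExceptionalZeroPrimeSums.lean`, which vendors the first bound of Proposition 3.5 specialised to
square-free conductors `q ≡ 3 (mod 4)` and the Jacobi symbol, `TaoTeravainen2021_prop35`, for
Granville–Mollin's theorem). Here the SAME proposition is vendored for an arbitrary primitive
quadratic character — the form consumed by the proof of Tao–Teräväinen's Theorem 1.6
(`Literature/Barriers/Parity/SiegelZeroDichotomyChowla.lean`, step (i) = Proposition 4.2) — together
with its second bound, and Corollary 3.6 (first bound) is PROVED from them:

* `excPrimes χ s` — the exceptional primes in `s`: primes `p*` with `χ(p*) ≠ -1` (§2.3);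
* `TaoTeravainen2021_eq313`, `TaoTeravainen2021_eq314` — NAMED FACTS, Proposition 3.5, (3.13) and
  (3.14);
* `TaoTeravainen2021_cor36_i` — Corollary 3.6, first bound, as a `Prop`, and
  `TaoTeravainen2021_cor36_i_of_prop35 : eq313 → eq314 → cor36_i` — PROVED (the covering of
  `[R₀, x]` by the ranges of (3.14) with the corollary's own `ε` and `2 ≤ m ≤ ⌈√log η⌉ + 1`, plus
  the range `(q^{(1+ε)/2}, x]` of (3.13)).

## What the source prints (arXiv:2109.06291; numbering of J. London Math. Soc. 106 (2022))

* Definition 1.4: "A Siegel zero `β` is a real number associated to a primitive quadratic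
  Dirichlet character `χ` of conductor `q_χ` such that `L(β, χ) = 0` and `β = 1 - 1/(η log q_χ)`
  for some `η ≥ 10` (which we call the quality of the zero)." §2.1: "`X ≪ Y` … `|X| ≤ CY` where
  `C` is a constant which is allowed to depend on the "fixed" quantities …; we permit the constants
  to be ineffective … `X ≪_A Y` … `C_A` depends on the parameter `A` as well"; "We will also
  assume that `η` is sufficiently large depending on the fixed quantities"; "we do not impose the
  restriction (1.7) on `x > 1` before Section 4". §2.3: "We define an exceptional prime to be a
  prime `p*` such that `χ(p*) ≠ -1`; sums over `p*` … will always be understood to be over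
  exceptional primes." (2.5): "`R₀ := x^{1/√(log η)}`."
* **Proposition 3.5.** "Let `ε > 0`. Then for any `x ≥ q_χ^{(1+ε)/2}`, one has
  (3.13) `∑_{q_χ^{(1+ε)/2} < p* ≤ x} 1/p* ≪_ε (log_{q_χ} x)/η`
  and for any natural number `m ≥ 2`, we have
  (3.14) `∑_{q_χ^{(1+ε)/(2m)} < p* ≤ q_χ^{(1+ε)/(2(m-1))}} 1/p* ≪_ε m/η^{1/m}`."
  (Proof: Montgomery–Vaughan's `∑_{n ≤ x} (1∗χ)(n)/n = (log x + γ)L(1,χ) + L'(1,χ) + O_ε(q^{-ε/10})`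
  for `x ≥ q^{(1+ε)/2}`, Siegel's theorem `L(1,χ) ≫_ε q^{-ε/10}`, `L'/L(1,χ) ≍ η log q_χ`, and the
  non-negativity and multiplicativity of `1∗χ`.)
* **Corollary 3.6.** "Let `q_χ^{(1+ε)/2} ≤ x ≤ q_χ^{η^{1/2}}`. We have
  `∑_{R₀ ≤ p* ≤ x} 1/p* ≪ exp(-√(log η)/2)` and [a second bound, not vendored here]. This bound
  will be used in steps (i), (ii) of the main argument." (Proof of the first bound: (3.13) on
  `q_χ < p* ≤ x` gives `≪ √η/η`; (3.14) on `q_χ^{1/m} < p* ≤ q_χ^{1/(m-1)}`, "Summing over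
  `2 ≤ m ≤ √(log η) + 1`, we obtain the first claim.")
  [cite: TaoTeravainen2021, Definition 1.4, §2.1, §2.3, (2.5), Proposition 3.5, Corollary 3.6]

## Design notes

1. Hypotheses are inlined as in `ExceptionalZeroPrimeSums.lean` (`χ` primitive and quadratic mod
   `q`, `L(1 - 1/(η log q), χ) = 0`), for every conductor `q`; "`η` sufficiently large" and "`≪_ε`"
   become `∃ K η₀` placed after `ε` (the constants may be ineffective). Real `x`; a prime `p` lies
   in `(a, b]` iff `⌊a⌋₊ < p ≤ ⌊b⌋₊` and in `[a, b]` iff `⌈a⌉₊ ≤ p ≤ ⌊b⌋₊` (`a, b ≥ 0`), which is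
   how the ranges are written (`Finset.Ioc`, `Finset.Icc`).
2. The proof of Corollary 3.6 (i) given here covers `[R₀, q^{(1+ε)/2}]` by the ranges of (3.14)
   taken with the corollary's own `ε` (for `x ≥ q^{(1+ε)/2}` one has `R₀ ≥ q^{(1+ε)/(2√log η)}`,
   so `2 ≤ m ≤ ⌈√log η⌉ + 1` suffices and `∑_m m η^{-1/m} ≤ M² η^{-1/M} ≤ 16e² exp(-√(log η)/2)`),
   and `(q^{(1+ε)/2}, x]` by (3.13) (`≪ √η/η ≤ exp(-√(log η)/2)`); the implied constant depends on
   `ε`, as the source's conventions allow. At `q = 1` the zero hypothesis reads `ζ(1) = 0`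
   (Mathlib's `LFunction_modOne_eq`) and is refuted by `riemannZeta_one_ne_zero`, so `q ≥ 2`
   throughout (`two_le_of_LFunction_eq_zero`).
3. NOT here: the second bound of Corollary 3.6 (only needed for `k ≥ 1`), and the proof of
   Proposition 3.5 (its inputs: Siegel's theorem — proved in this tree,
   `SiegelTheorem.lean` — and Montgomery–Vaughan §11 asymptotics, see the sibling file's notes).
-/

noncomputable section

open Finset Real

namespace Literature.NumberTheory.LFunctions.SiegelZero

/-! ### Exceptional primes -/

open Classical in
/-- The **exceptional primes** in a finite set `s`: the primes `p*` with `χ(p*) ≠ -1` ("We define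
an exceptional prime to be a prime `p*` such that `χ(p*) ≠ -1`"). [cite: TaoTeravainen2021, §2.3] -/
def excPrimes {q : ℕ} (χ : DirichletCharacter ℂ q) (s : Finset ℕ) : Finset ℕ :=
  s.filter fun p => p.Prime ∧ χ (p : ZMod q) ≠ -1

/-- Membership in `excPrimes`. [cite: TaoTeravainen2021, §2.3] -/
theorem mem_excPrimes {q : ℕ} {χ : DirichletCharacter ℂ q} {s : Finset ℕ} {p : ℕ} :
    p ∈ excPrimes χ s ↔ p ∈ s ∧ p.Prime ∧ χ (p : ZMod q) ≠ -1 := by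
  simp [excPrimes]

/-- At `q = 1` the "Siegel zero" hypothesis `L(1 - 1/(η log q), χ) = 0` reads `ζ(1) = 0` in Mathlib's
conventions (`1/0 = 0`, `LFunction_modOne_eq`) and is false; so a conductor carrying such a zero is
`≥ 2`. [folklore] -/
theorem two_le_of_LFunction_eq_zero {q : ℕ} [NeZero q] {χ : DirichletCharacter ℂ q} {η : ℝ}
    (hL : χ.LFunction ((1 - 1 / (η * Real.log q) : ℝ) : ℂ) = 0) : 2 ≤ q := by
  by_contra hq
  obtain rfl : q = 1 := by have := NeZero.one_le (n := q); omega
  simp only [Nat.cast_one, Real.log_one, mul_zero, div_zero, sub_zero, Complex.ofReal_one,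
    DirichletCharacter.LFunction_modOne_eq] at hL
  exact riemannZeta_one_ne_zero hL

/-! ### Proposition 3.5 (general conductor), named facts -/

/-- **Tao–Teräväinen 2022, Proposition 3.5, first bound (3.13)** (any conductor): "Let `ε > 0`.
Then for any `x ≥ q_χ^{(1+ε)/2}`, one has `∑_{q_χ^{(1+ε)/2} < p* ≤ x} 1/p* ≪_ε (log_{q_χ} x)/η`",
for a Siegel zero `β = 1 - 1/(η log q_χ)` of `L(s, χ)`, `χ` primitive quadratic mod `q_χ`, `η`
sufficiently large, the constant depending on `ε` (possibly ineffective). Rendered: for every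
`ε > 0` there are `K`, `η₀` such that for every `q`, every primitive quadratic `χ` mod `q`, every
`η ≥ η₀` with `L(1 - 1/(η log q), χ) = 0` and every real `x ≥ q^{(1+ε)/2}`:
`∑_{p* exceptional, q^{(1+ε)/2} < p* ≤ x} 1/p* ≤ K (log x/log q)/η`. A NAMED FACT.
[cite: TaoTeravainen2021, Proposition 3.5 (3.13)] -/
def TaoTeravainen2021_eq313 : Prop :=
  ∀ ε : ℝ, 0 < ε → ∃ K η₀ : ℝ, ∀ (q : ℕ) [NeZero q] (χ : DirichletCharacter ℂ q), χ.IsPrimitive →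
    χ.IsQuadratic → ∀ η : ℝ, η₀ ≤ η → χ.LFunction ((1 - 1 / (η * Real.log q) : ℝ) : ℂ) = 0 →
      ∀ x : ℝ, (q : ℝ) ^ ((1 + ε) / 2) ≤ x →
        ∑ p ∈ excPrimes χ (Ioc ⌊(q : ℝ) ^ ((1 + ε) / 2)⌋₊ ⌊x⌋₊), (1 : ℝ) / p ≤
          K * (Real.log x / Real.log q) / η

/-- **Tao–Teräväinen 2022, Proposition 3.5, second bound (3.14)** (any conductor): "for any natural
number `m ≥ 2`, we have `∑_{q_χ^{(1+ε)/(2m)} < p* ≤ q_χ^{(1+ε)/(2(m-1))}} 1/p* ≪_ε m/η^{1/m}`", same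
standing hypotheses and conventions as `TaoTeravainen2021_eq313`. A NAMED FACT.
[cite: TaoTeravainen2021, Proposition 3.5 (3.14)] -/
def TaoTeravainen2021_eq314 : Prop :=
  ∀ ε : ℝ, 0 < ε → ∃ K η₀ : ℝ, ∀ (q : ℕ) [NeZero q] (χ : DirichletCharacter ℂ q), χ.IsPrimitive →
    χ.IsQuadratic → ∀ η : ℝ, η₀ ≤ η → χ.LFunction ((1 - 1 / (η * Real.log q) : ℝ) : ℂ) = 0 →
      ∀ m : ℕ, 2 ≤ m →
        ∑ p ∈ excPrimes χ (Ioc ⌊(q : ℝ) ^ ((1 + ε) / (2 * m))⌋₊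
            ⌊(q : ℝ) ^ ((1 + ε) / (2 * ((m : ℝ) - 1)))⌋₊), (1 : ℝ) / p ≤
          K * m / η ^ ((1 : ℝ) / m)

/-! ### Corollary 3.6, first bound -/

/-- **Tao–Teräväinen 2022, Corollary 3.6, first bound** (any conductor), as a `Prop`: for every
`ε > 0` there are `K`, `η₀` such that for every primitive quadratic `χ` mod `q`, every `η ≥ η₀`
with `L(1 - 1/(η log q), χ) = 0` and every `q^{(1+ε)/2} ≤ x ≤ q^{η^{1/2}}`:
`∑_{R₀ ≤ p* ≤ x} 1/p* ≤ K exp(-√(log η)/2)`, `R₀ = x^{1/√(log η)}` ((2.5)). Proved below from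
Proposition 3.5 (`TaoTeravainen2021_cor36_i_of_prop35`). [cite: TaoTeravainen2021, Corollary 3.6 (first bound) and (2.5)] -/
def TaoTeravainen2021_cor36_i : Prop :=
  ∀ ε : ℝ, 0 < ε → ∃ K η₀ : ℝ, ∀ (q : ℕ) [NeZero q] (χ : DirichletCharacter ℂ q), χ.IsPrimitive →
    χ.IsQuadratic → ∀ η : ℝ, η₀ ≤ η → χ.LFunction ((1 - 1 / (η * Real.log q) : ℝ) : ℂ) = 0 →
      ∀ x : ℝ, (q : ℝ) ^ ((1 + ε) / 2) ≤ x → x ≤ (q : ℝ) ^ Real.sqrt η →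
        ∑ p ∈ excPrimes χ (Icc ⌈x ^ (1 / Real.sqrt (Real.log η))⌉₊ ⌊x⌋₊), (1 : ℝ) / p ≤
          K * Real.exp (-Real.sqrt (Real.log η) / 2)

/-- The numerical inequality behind "Summing over `2 ≤ m ≤ √(log η) + 1`": for `s ≥ 2`,
`(s + 2)² e^{2 - s} ≤ 16 e² e^{-s/2}` (from `e^{s/4} ≥ 1 + s/4`). [folklore] -/
theorem sq_mul_exp_le {s : ℝ} (hs : 0 ≤ s) :
    (s + 2) ^ 2 * Real.exp (2 - s) ≤ 16 * Real.exp 2 * Real.exp (-s / 2) := by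
  have h1 : 1 + s / 4 ≤ Real.exp (s / 4) := by linarith [Real.add_one_le_exp (s / 4)]
  have h2 : (1 + s / 4) ^ 2 ≤ Real.exp (s / 4) ^ 2 := by gcongr
  have h3 : Real.exp (s / 4) ^ 2 = Real.exp (s / 2) := by rw [← Real.exp_nat_mul]; ring_nf
  have h4 : (s + 2) ^ 2 ≤ 16 * Real.exp (s / 2) := by nlinarith
  have h5 : Real.exp (2 - s) = Real.exp 2 * Real.exp (-s / 2) / Real.exp (s / 2) := by
    rw [← Real.exp_add, ← Real.exp_sub]; ring_nf
  rw [h5]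
  have h6 : 0 < Real.exp (s / 2) := Real.exp_pos _
  rw [mul_div_assoc', div_le_iff₀ h6]
  have h7 : 0 ≤ Real.exp 2 * Real.exp (-s / 2) := by positivity
  nlinarith

/-- **Corollary 3.6 (first bound) from Proposition 3.5.** [cite: TaoTeravainen2021, Corollary 3.6 (proof of the first claim)] -/
theorem TaoTeravainen2021_cor36_i_of_prop35 (h₁ : TaoTeravainen2021_eq313)
    (h₂ : TaoTeravainen2021_eq314) : TaoTeravainen2021_cor36_i := by
  intro ε hε
  -- work with `ε' = min ε 1 ≤ 1`
  set ε' : ℝ := min ε 1 with hε'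
  have hε'0 : 0 < ε' := lt_min hε one_pos
  have hε'ε : ε' ≤ ε := min_le_left _ _
  obtain ⟨K₁, η₁, H₁⟩ := h₁ ε' hε'0
  obtain ⟨K₂, η₂, H₂⟩ := h₂ ε' hε'0
  set K₁' : ℝ := max K₁ 0 with hK₁'
  set K₂' : ℝ := max K₂ 0 with hK₂'
  refine ⟨K₁' + 16 * Real.exp 2 * K₂', max (max η₁ η₂) (Real.exp 4), ?_⟩
  intro q _ χ hprim hquad η hη hL x hlo hhi
  have hη₁ : η₁ ≤ η := (le_max_left _ _).trans ((le_max_left _ _).trans hη)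
  have hη₂ : η₂ ≤ η := (le_max_right _ _).trans ((le_max_left _ _).trans hη)
  have hηe : Real.exp 4 ≤ η := (le_max_right _ _).trans hη
  have hη0 : 0 < η := (Real.exp_pos 4).trans_le hηe
  have hη1 : 1 ≤ η := by linarith [Real.add_one_le_exp (4 : ℝ)]
  -- `L = log η ≥ 4`, `s = √L ≥ 2`
  set L : ℝ := Real.log η with hLdef
  have hL4 : 4 ≤ L := by rw [hLdef, ← Real.log_exp 4]; exact Real.log_le_log (Real.exp_pos 4) hηe
  set s : ℝ := Real.sqrt L with hsdef
  have hs2 : 2 ≤ s := by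
    rw [hsdef, show (2 : ℝ) = Real.sqrt 4 by rw [show (4 : ℝ) = 2 ^ 2 by norm_num,
      Real.sqrt_sq (by norm_num : (0 : ℝ) ≤ 2)]]
    exact Real.sqrt_le_sqrt hL4
  have hs0 : 0 < s := by linarith
  have hsL : s ^ 2 = L := by rw [hsdef, Real.sq_sqrt (by linarith)]
  -- the conductor
  have hq2 : 2 ≤ q := two_le_of_LFunction_eq_zero hL
  have hq1 : (1 : ℝ) < q := by exact_mod_cast hq2
  have hq0 : (0 : ℝ) < q := by linarith
  have hlogq : 0 < Real.log q := Real.log_pos hq1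
  -- `x ≥ q^{(1+ε')/2} ≥ 1`
  have hlo' : (q : ℝ) ^ ((1 + ε') / 2) ≤ x :=
    (Real.rpow_le_rpow_of_exponent_le hq1.le (by linarith)).trans hlo
  have hx1 : 1 ≤ x := (Real.one_le_rpow hq1.le (by linarith)).trans hlo'
  have hx0 : 0 < x := by linarith
  -- `M = ⌈s⌉ + 1`
  set M : ℕ := ⌈s⌉₊ + 1 with hMdef
  have hsM : s < M := by
    rw [hMdef]; push_cast; linarith [Nat.le_ceil s]
  have hMs : (M : ℝ) ≤ s + 2 := by
    rw [hMdef]; push_cast; linarith [Nat.ceil_lt_add_one hs0.le]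
  have hM2 : 2 ≤ M := by
    have : 1 ≤ ⌈s⌉₊ := Nat.one_le_iff_ne_zero.mpr (by
      intro h; rw [Nat.ceil_eq_zero] at h; linarith)
    omega
  have hM0 : (0 : ℝ) < M := by exact_mod_cast (show 0 < M by omega)
  -- the pieces
  set R₀ : ℝ := x ^ (1 / s) with hR₀
  set A : Finset ℕ := excPrimes χ (Ioc ⌊(q : ℝ) ^ ((1 + ε') / 2)⌋₊ ⌊x⌋₊) with hA
  set B : ℕ → Finset ℕ := fun m => excPrimes χ (Ioc ⌊(q : ℝ) ^ ((1 + ε') / (2 * m))⌋₊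
      ⌊(q : ℝ) ^ ((1 + ε') / (2 * ((m : ℝ) - 1)))⌋₊) with hB
  -- `R₀ ≥ q^{(1+ε')/(2s)} > q^{(1+ε')/(2M)}`
  have hR₀lo : (q : ℝ) ^ ((1 + ε') / (2 * s)) ≤ R₀ := by
    have : ((q : ℝ) ^ ((1 + ε') / 2)) ^ (1 / s) ≤ x ^ (1 / s) :=
      Real.rpow_le_rpow (by positivity) hlo' (by positivity)
    rw [← Real.rpow_mul hq0.le] at this
    convert this using 2
    field_simp
  have hRM : (q : ℝ) ^ ((1 + ε') / (2 * M)) < R₀ := by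
    refine lt_of_lt_of_le (Real.rpow_lt_rpow_of_exponent_lt hq1 ?_) hR₀lo
    rw [div_lt_div_iff_of_pos_left (by linarith) (by positivity) (by positivity)]
    linarith
  -- covering: every exceptional prime in `[R₀, x]` lies in `A` or in some `B m`, `2 ≤ m ≤ M`
  have hcover : excPrimes χ (Icc ⌈R₀⌉₊ ⌊x⌋₊) ⊆ A ∪ (Icc 2 M).biUnion B := by
    intro p hp
    rw [mem_excPrimes, mem_Icc] at hp
    obtain ⟨⟨hpR, hpx⟩, hpp, hpχ⟩ := hp
    have hpR' : R₀ ≤ p := Nat.ceil_le.mp hpR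
    rw [mem_union, mem_biUnion]
    by_cases hpa : (q : ℝ) ^ ((1 + ε') / 2) < p
    · left
      rw [hA, mem_excPrimes, mem_Ioc]
      exact ⟨⟨(Nat.floor_lt (by positivity)).mpr hpa, hpx⟩, hpp, hpχ⟩
    · right
      rw [not_lt] at hpa
      -- the least `m ∈ [2, M]` with `q^{(1+ε')/(2m)} < p`
      set T : Finset ℕ := (Icc 2 M).filter fun m => (q : ℝ) ^ ((1 + ε') / (2 * m)) < p with hT
      have hMT : M ∈ T := by
        rw [hT, mem_filter, mem_Icc]
        exact ⟨⟨hM2, le_rfl⟩, hRM.trans_le hpR'⟩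
      have hTne : T.Nonempty := ⟨M, hMT⟩
      set m : ℕ := T.min' hTne with hm
      have hmT : m ∈ T := min'_mem T hTne
      rw [hT, mem_filter, mem_Icc] at hmT
      obtain ⟨⟨hm2, hmM⟩, hmp⟩ := hmT
      refine ⟨m, mem_Icc.mpr ⟨hm2, hmM⟩, ?_⟩
      rw [hB, mem_excPrimes, mem_Ioc]
      refine ⟨⟨(Nat.floor_lt (by positivity)).mpr hmp, (Nat.le_floor_iff (by positivity)).mpr ?_⟩,
        hpp, hpχ⟩
      -- `p ≤ q^{(1+ε')/(2(m-1))}`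
      rcases Nat.lt_or_ge 2 m with h3m | hm2'
      · -- `m ≥ 3`: `m - 1 ∉ T` by minimality
        have hnot : m - 1 ∉ T := by
          intro hmem
          have := min'_le T (m - 1) hmem
          omega
        rw [hT, mem_filter, mem_Icc, not_and, not_lt] at hnot
        have h := hnot ⟨by omega, by omega⟩
        have hcast : (((m - 1 : ℕ) : ℝ)) = (m : ℝ) - 1 := by
          rw [Nat.cast_sub (by omega)]; simp
        rw [hcast] at h
        exact h
      · -- `m = 2`: the range ends at `q^{(1+ε')/2}`
        have hm_eq : m = 2 := le_antisymm hm2' hm2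
        rw [hm_eq]
        norm_num
        exact hpa
  -- the sum over the cover (sums of the non-negative `1/p` over unions)
  have hf : ∀ p : ℕ, 0 ≤ (1 : ℝ) / p := fun p => by positivity
  have hunion : ∀ s t : Finset ℕ,
      ∑ p ∈ s ∪ t, (1 : ℝ) / p ≤ ∑ p ∈ s, (1 : ℝ) / p + ∑ p ∈ t, (1 : ℝ) / p := by
    intro s t
    have h1 := Finset.sum_union_inter (s₁ := s) (s₂ := t) (f := fun p : ℕ => (1 : ℝ) / p)
    have h2 : 0 ≤ ∑ p ∈ s ∩ t, (1 : ℝ) / p := Finset.sum_nonneg fun p _ => hf p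
    linarith
  have hbU : ∀ S : Finset ℕ,
      ∑ p ∈ S.biUnion B, (1 : ℝ) / p ≤ ∑ m ∈ S, ∑ p ∈ B m, (1 : ℝ) / p := by
    intro S
    induction S using Finset.induction_on with
    | empty => simp
    | insert i S hi ih =>
      rw [Finset.biUnion_insert, Finset.sum_insert hi]
      exact (hunion _ _).trans (by linarith)
  have hsum : ∑ p ∈ excPrimes χ (Icc ⌈R₀⌉₊ ⌊x⌋₊), (1 : ℝ) / p ≤
      ∑ p ∈ A, (1 : ℝ) / p + ∑ m ∈ Icc 2 M, ∑ p ∈ B m, (1 : ℝ) / p :=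
    calc ∑ p ∈ excPrimes χ (Icc ⌈R₀⌉₊ ⌊x⌋₊), (1 : ℝ) / p
        ≤ ∑ p ∈ A ∪ (Icc 2 M).biUnion B, (1 : ℝ) / p :=
          sum_le_sum_of_subset_of_nonneg hcover fun p _ _ => hf p
      _ ≤ ∑ p ∈ A, (1 : ℝ) / p + ∑ p ∈ (Icc 2 M).biUnion B, (1 : ℝ) / p := hunion _ _
      _ ≤ _ := by gcongr; exact hbU _
  -- piece `A`: (3.13)
  have hAle : ∑ p ∈ A, (1 : ℝ) / p ≤ K₁' * Real.exp (-s / 2) := by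
    have h := H₁ q χ hprim hquad η hη₁ hL x hlo'
    have hratio : Real.log x / Real.log q ≤ Real.sqrt η := by
      rw [div_le_iff₀ hlogq]
      have := Real.log_le_log hx0 hhi
      rwa [Real.log_rpow hq0] at this
    have hratio0 : 0 ≤ Real.log x / Real.log q := div_nonneg (Real.log_nonneg hx1) hlogq.le
    have h2 : K₁ * (Real.log x / Real.log q) / η ≤ K₁' * Real.sqrt η / η :=
      div_le_div_of_nonneg_right ((mul_le_mul_of_nonneg_right (le_max_left _ _) hratio0).trans
          (mul_le_mul_of_nonneg_left hratio (le_max_right _ _))) hη0.le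
    have h3 : Real.sqrt η / η = Real.exp (-L / 2) := by
      have hsq : Real.sqrt η = Real.exp (L / 2) := by
        rw [hLdef, Real.sqrt_eq_rpow, Real.rpow_def_of_pos hη0]; ring_nf
      have hηL : η = Real.exp L := by rw [hLdef, Real.exp_log hη0]
      rw [hsq]
      rw [hηL]
      rw [← Real.exp_sub]
      congr 1
      ring
    have h4 : Real.exp (-L / 2) ≤ Real.exp (-s / 2) := by
      rw [Real.exp_le_exp]
      have : s ≤ L := by nlinarith
      linarith
    calc ∑ p ∈ A, (1 : ℝ) / p ≤ K₁ * (Real.log x / Real.log q) / η := h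
      _ ≤ K₁' * Real.sqrt η / η := h2
      _ = K₁' * Real.exp (-L / 2) := by rw [mul_div_assoc, h3]
      _ ≤ K₁' * Real.exp (-s / 2) := mul_le_mul_of_nonneg_left h4 (le_max_right _ _)
  -- pieces `B m`: (3.14)
  have hBle : ∀ m ∈ Icc 2 M, ∑ p ∈ B m, (1 : ℝ) / p ≤ K₂' * M * Real.exp (2 - s) := by
    intro m hm
    rw [mem_Icc] at hm
    have hm0 : (0 : ℝ) < m := by exact_mod_cast (show 0 < m by omega)
    have h := H₂ q χ hprim hquad η hη₂ hL m hm.1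
    have hpow : η ^ ((1 : ℝ) / m) ≥ η ^ ((1 : ℝ) / M) :=
      Real.rpow_le_rpow_of_exponent_le hη1 (by
        rw [div_le_div_iff_of_pos_left one_pos hM0 hm0]; exact_mod_cast hm.2)
    have hpowM : η ^ ((1 : ℝ) / M) = Real.exp (L / M) := by
      rw [Real.rpow_def_of_pos hη0, hLdef]; ring_nf
    have hpowpos : 0 < η ^ ((1 : ℝ) / m) := Real.rpow_pos_of_pos hη0 _
    have hLM : s - 2 ≤ L / M := by
      rw [le_div_iff₀ hM0]
      nlinarith
    calc ∑ p ∈ B m, (1 : ℝ) / p ≤ K₂ * m / η ^ ((1 : ℝ) / m) := h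
      _ ≤ K₂' * M / η ^ ((1 : ℝ) / M) := by
          have hnum : K₂ * m ≤ K₂' * M :=
            (mul_le_mul_of_nonneg_right (le_max_left _ _) hm0.le).trans
              (mul_le_mul_of_nonneg_left (by exact_mod_cast hm.2) (le_max_right _ _))
          have hnum0 : 0 ≤ K₂' * M := mul_nonneg (le_max_right _ _) hM0.le
          calc K₂ * m / η ^ ((1 : ℝ) / m) ≤ K₂' * M / η ^ ((1 : ℝ) / m) :=
                div_le_div_of_nonneg_right hnum hpowpos.le
            _ ≤ K₂' * M / η ^ ((1 : ℝ) / M) :=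
                div_le_div_of_nonneg_left hnum0 (Real.rpow_pos_of_pos hη0 _) hpow
      _ = K₂' * M * Real.exp (-(L / M)) := by rw [hpowM, Real.exp_neg, div_eq_mul_inv]
      _ ≤ K₂' * M * Real.exp (2 - s) := by
          refine mul_le_mul_of_nonneg_left (Real.exp_le_exp.mpr (by linarith))
            (mul_nonneg (le_max_right _ _) hM0.le)
  have hBsum : ∑ m ∈ Icc 2 M, ∑ p ∈ B m, (1 : ℝ) / p ≤ 16 * Real.exp 2 * K₂' * Real.exp (-s / 2) :=
    calc ∑ m ∈ Icc 2 M, ∑ p ∈ B m, (1 : ℝ) / p ≤ ∑ _m ∈ Icc 2 M, K₂' * M * Real.exp (2 - s) :=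
          sum_le_sum hBle
      _ = ((M + 1 - 2 : ℕ) : ℝ) * (K₂' * M * Real.exp (2 - s)) := by
          rw [sum_const, Nat.card_Icc, nsmul_eq_mul]
      _ ≤ (M : ℝ) * (K₂' * M * Real.exp (2 - s)) := by
          refine mul_le_mul_of_nonneg_right ?_ (by positivity)
          exact_mod_cast (show M + 1 - 2 ≤ M by omega)
      _ = K₂' * ((M : ℝ) ^ 2 * Real.exp (2 - s)) := by ring
      _ ≤ K₂' * ((s + 2) ^ 2 * Real.exp (2 - s)) := by
          refine mul_le_mul_of_nonneg_left ?_ (le_max_right _ _)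
          gcongr
      _ ≤ K₂' * (16 * Real.exp 2 * Real.exp (-s / 2)) :=
          mul_le_mul_of_nonneg_left (sq_mul_exp_le hs0.le) (le_max_right _ _)
      _ = 16 * Real.exp 2 * K₂' * Real.exp (-s / 2) := by ring
  calc ∑ p ∈ excPrimes χ (Icc ⌈R₀⌉₊ ⌊x⌋₊), (1 : ℝ) / p
      ≤ ∑ p ∈ A, (1 : ℝ) / p + ∑ m ∈ Icc 2 M, ∑ p ∈ B m, (1 : ℝ) / p := hsum
    _ ≤ K₁' * Real.exp (-s / 2) + 16 * Real.exp 2 * K₂' * Real.exp (-s / 2) :=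
        add_le_add hAle hBsum
    _ = (K₁' + 16 * Real.exp 2 * K₂') * Real.exp (-s / 2) := by ring

end Literature.NumberTheory.LFunctions.SiegelZero
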